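/-
Copyright: statement-level skeleton of a published paper (lit-balaban cell, Phase-2 proof seat p20, gen 3). No claims beyond
what the kernel checks below.
-/
import Literature.MathematicalPhysics.QuantumFieldTheory.Balaban1983to89.B3Sect3TriangleGraphs
import Literature.MathematicalPhysics.QuantumFieldTheory.Balaban1983to89.B3SubtractionAlphaGain

/-!
# `Balaban1983to89.B3TriangleAlphaGain` — T. Bałaban, *(Higgs)₂,₃ quantum fields in a finite volume. III. Renormalization*,
Commun. Math. Phys. **88** (1983) 411–445 [Balaban1983Higgs3], pp. 443–444: *"This gives us a convergent expression plus the
expression (3.36)"* — the two transported terms of (3.34) gain `(L^jη)^α`, PROVED as a quantitative bound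

statement-level skeleton of published theorems with citation tags; proofs where landed; nothing here is a claim about the Yang–Mills mass gap

PDF held: `paper:balaban1983-higgs-2-3-quantum-fields-finite-volume` (journal page = PDF page + 410); pp. 443–444 read on the ×2
renders `run/shared/lean/pub/pub-balaban/b2b-balaban-ref1/pages/1983-cmp88-higgs23-III/1983-cmp88-higgs23-III-p033-x2.png`,
`…-p034-x2.png`.

CITATION HEADER (lean-in-tree rule).  lit-balaban PHASE 2, seat p20 (gen 3), row **B3.Eq3.33-3.38** (owner r15, referee ref-4).
r15 PROVED (3.34) as algebra (`B3Sect3TriangleGraphs.eq334`: (3.33) = the two transported terms + the local term `local334`);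
page 444, verbatim: *"This gives us a convergent expression plus the expression [(3.36)]"*.  WHAT IS HERE: the quantitative content
of "convergent" for the two transported terms of (3.34), in the sense of (2.14)/(3.14) — for a three-point kernel with a
(2.10)-type tree bound through the vertex `x′` to which the legs are transported,
`‖Γ_μ(x,x′,x″)v‖ ≤ K e^{−δ|x−x′|/s} e^{−δ|x′−x″|/s}‖v‖` (scale `s = L^jη`), Hölder legs `|gA_μ(x) − gA_μ(x′)| ≤ H₁|x−x′|^α`,
`‖φ″(x″) − φ″(x′)‖ ≤ H₂|x′−x″|^α` and sup bounds `|gA_μ| ≤ B₁`, `‖φ″‖ ≤ B₂`, the two terms are bounded by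
`d·K·(H₁B₂ + B₁H₂)·(1 + 2/δ)·s^α` times the degree-0 majorant `Σ_{x,x′,x″}η^{3d}‖φ′(x′)‖e^{−½δ|x−x′|/s}e^{−½δ|x′−x″|/s}`
(`abs_convergent334_le`; the plain-difference forms `abs_tripleSum_first_le`, `abs_tripleSum_second_le`; the weights
`|x−x′|^α = (η·supDist)^α` of `eq334` cancel, `tripleSum_weight_cancel_first/second`).  The elementary gain is
`B3SubtractionAlphaGain.exp_mul_rpow_le`.  Distances `|x − x′| = η·Site.tdist x x′` (ℓ¹ torus distance of `Setup`); the kernel bound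
itself (Papers I/IV, (2.10)–(2.12)) is the hypothesis `hΓ`, not asserted.  Unit `lit-balaban-p20`
(literature-prover-lit-balaban-p20-g3-0), 2026-08-21; HOME `run/shared/lean/pub/lit-balaban/` (FILED.md).
-/

open scoped BigOperators RealInnerProductSpace

namespace Literature.MathematicalPhysics.QuantumFieldTheory.Balaban1983to89.B3TriangleAlphaGain

open LatticeFieldCalculus B3Sect3ScalarSelfEnergy B3Sect3VectorSelfEnergy B3Sect3TriangleGraphs B3SubtractionAlphaGain

noncomputable section

variable {P : Params} {j : ℕ} {W : Type*} [NormedAddCommGroup W] [InnerProductSpace ℝ W]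

/-! ## 1. The weights of (3.34) cancel inside the three-point pairing -/

/-- kernel: on the torus, sup-distance 0 means equality. [folklore] -/
private theorem eq_of_supDist_eq_zero (x x' : Site P j) (h : supDist x x' = 0) : x = x' := by
  funext μ
  have hle : min (x μ - x' μ).val (x' μ - x μ).val ≤ supDist x x' :=
    Finset.le_sup (f := fun μ : Fin P.d => min (x μ - x' μ).val (x' μ - x μ).val) (Finset.mem_univ μ)
  rw [h, Nat.le_zero, Nat.min_eq_zero_iff, ZMod.val_eq_zero, ZMod.val_eq_zero, sub_eq_zero, sub_eq_zero] at hle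
  rcases hle with h1 | h1
  · exact h1
  · exact h1.symm

/-- kernel: the printed weight `|x−x′|^α = (η·supDist)^α` vanishes only on the diagonal (`η > 0`). [folklore] -/
private theorem rpow_dist_eq_zero {η : ℝ} (hη : 0 < η) (α : ℝ) (x x' : Site P j)
    (h0 : (η * (supDist x x' : ℝ)) ^ α = 0) : x = x' := by
  have hnn : 0 ≤ η * (supDist x x' : ℝ) := by positivity
  rw [Real.rpow_eq_zero_iff_of_nonneg hnn] at h0
  have h1 : (supDist x x' : ℝ) = 0 := by
    rcases mul_eq_zero.1 h0.1 with h2 | h2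
    · exact absurd h2 hη.ne'
    · exact h2
  exact eq_of_supDist_eq_zero x x' (by exact_mod_cast h1)

/-- kernel: in the FIRST transported term of (3.34) the weight cancels — `Σ η^{3d}Σ_μ (D_μ(x,x′)/w)·φ′(x′)·Γ(w φ″(x″)) =
Σ η^{3d}Σ_μ D_μ(x,x′)·φ′(x′)·Γφ″(x″)` for a weight `w` vanishing only on the diagonal and a leg difference `D` vanishing on it.
[cite: Balaban1983Higgs3, (3.34) p.443] -/
theorem tripleSum_weight_cancel_first (η : ℝ) (Γ : Kernel3 P j W) (φ' φ'' : SiteField P j W)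
    (w : Site P j → Site P j → ℝ) (hw : ∀ x x' : Site P j, w x x' = 0 → x = x')
    (D : Fin P.d → Site P j → Site P j → ℝ) (hD : ∀ (μ : Fin P.d) (x : Site P j), D μ x x = 0) :
    tripleSum η Γ (fun μ x x' => D μ x x' / w x x') φ' (fun x x' x'' => w x x' • φ'' x'') =
      tripleSum η Γ D φ' (fun _ _ x'' => φ'' x'') := by
  unfold tripleSum
  refine Finset.sum_congr rfl fun x _ => Finset.sum_congr rfl fun x' _ => Finset.sum_congr rfl fun x'' _ => ?_
  congr 1
  refine Finset.sum_congr rfl fun μ _ => ?_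
  beta_reduce
  rw [map_smul, real_inner_smul_right]
  by_cases h0 : w x x' = 0
  · obtain rfl := hw x x' h0
    simp [hD]
  · rw [← mul_assoc, div_mul_cancel₀ _ h0]

/-- kernel: in the SECOND transported term of (3.34) the weight cancels — `w·(w⁻¹(φ″(x″) − φ″(x′))) = φ″(x″) − φ″(x′)` inside the
pairing, for a weight vanishing only on the diagonal. [cite: Balaban1983Higgs3, (3.34) p.443] -/
theorem tripleSum_weight_cancel_second (η : ℝ) (Γ : Kernel3 P j W) (F : Fin P.d → Site P j → Site P j → ℝ)
    (φ' φ'' : SiteField P j W) (w : Site P j → Site P j → ℝ) (hw : ∀ x x' : Site P j, w x x' = 0 → x = x') :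
    tripleSum η Γ F φ' (fun _ x' x'' => w x'' x' • ((w x'' x')⁻¹ • (φ'' x'' - φ'' x'))) =
      tripleSum η Γ F φ' (fun _ x' x'' => φ'' x'' - φ'' x') := by
  unfold tripleSum
  refine Finset.sum_congr rfl fun x _ => Finset.sum_congr rfl fun x' _ => Finset.sum_congr rfl fun x'' _ => ?_
  congr 1
  refine Finset.sum_congr rfl fun μ _ => ?_
  beta_reduce
  by_cases h0 : w x'' x' = 0
  · obtain rfl := hw x'' x' h0
    simp
  · rw [smul_smul, mul_inv_cancel₀ h0, one_smul]

/-! ## 2. The generic termwise bound of the three-point pairing -/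

/-- kernel: termwise majorisation of the three-point pairing — if `|F_μ(x,x′)|·‖Γ_μ(x,x′,x″)H(x,x′,x″)‖ ≤ c·E(x,x′,x″)` for all
`μ, x, x′, x″`, then `|tripleSum η Γ F φ′ H| ≤ d·c·Σ_{x,x′,x″}η^{3d}‖φ′(x′)‖E(x,x′,x″)` (`η ≥ 0`).
[cite: Balaban1983Higgs3, (3.34) p.443] -/
theorem abs_tripleSum_le (η : ℝ) (hη : 0 ≤ η) (Γ : Kernel3 P j W) (F : Fin P.d → Site P j → Site P j → ℝ)
    (φ' : SiteField P j W) (H : Site P j → Site P j → Site P j → W) (c : ℝ) (E : Site P j → Site P j → Site P j → ℝ)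
    (h : ∀ (μ : Fin P.d) (x x' x'' : Site P j), |F μ x x'| * ‖Γ μ x x' x'' (H x x' x'')‖ ≤ c * E x x' x'') :
    |tripleSum η Γ F φ' H| ≤
      P.d * c * ∑ x : Site P j, ∑ x' : Site P j, ∑ x'' : Site P j, η ^ (3 * P.d) * (‖φ' x'‖ * E x x' x'') := by
  -- per (x, x′, x″): the μ-sum
  have hinner : ∀ x x' x'' : Site P j,
      |η ^ (3 * P.d) * ∑ μ : Fin P.d, F μ x x' * ⟪φ' x', Γ μ x x' x'' (H x x' x'')⟫| ≤
        P.d * c * (η ^ (3 * P.d) * (‖φ' x'‖ * E x x' x'')) := by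
    intro x x' x''
    rw [abs_mul, abs_of_nonneg (by positivity : (0 : ℝ) ≤ η ^ (3 * P.d))]
    have hμ : ∀ μ : Fin P.d, |F μ x x' * ⟪φ' x', Γ μ x x' x'' (H x x' x'')⟫| ≤ ‖φ' x'‖ * (c * E x x' x'') := by
      intro μ
      rw [abs_mul]
      calc |F μ x x'| * |⟪φ' x', Γ μ x x' x'' (H x x' x'')⟫|
          ≤ |F μ x x'| * (‖φ' x'‖ * ‖Γ μ x x' x'' (H x x' x'')‖) :=
            mul_le_mul_of_nonneg_left (abs_real_inner_le_norm _ _) (abs_nonneg _)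
        _ = ‖φ' x'‖ * (|F μ x x'| * ‖Γ μ x x' x'' (H x x' x'')‖) := by ring
        _ ≤ ‖φ' x'‖ * (c * E x x' x'') := mul_le_mul_of_nonneg_left (h μ x x' x'') (norm_nonneg _)
    have hsum : |∑ μ : Fin P.d, F μ x x' * ⟪φ' x', Γ μ x x' x'' (H x x' x'')⟫| ≤
        ∑ _μ : Fin P.d, ‖φ' x'‖ * (c * E x x' x'') :=
      (Finset.abs_sum_le_sum_abs _ _).trans (Finset.sum_le_sum fun μ _ => hμ μ)
    rw [Finset.sum_const, Finset.card_univ, Fintype.card_fin, nsmul_eq_mul] at hsum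
    calc η ^ (3 * P.d) * |∑ μ : Fin P.d, F μ x x' * ⟪φ' x', Γ μ x x' x'' (H x x' x'')⟫|
        ≤ η ^ (3 * P.d) * (P.d * (‖φ' x'‖ * (c * E x x' x''))) := mul_le_mul_of_nonneg_left hsum (by positivity)
      _ = P.d * c * (η ^ (3 * P.d) * (‖φ' x'‖ * E x x' x'')) := by ring
  unfold tripleSum
  calc |∑ x : Site P j, ∑ x' : Site P j, ∑ x'' : Site P j, η ^ (3 * P.d) *
          ∑ μ : Fin P.d, F μ x x' * ⟪φ' x', Γ μ x x' x'' (H x x' x'')⟫|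
      ≤ ∑ x : Site P j, |∑ x' : Site P j, ∑ x'' : Site P j, η ^ (3 * P.d) *
          ∑ μ : Fin P.d, F μ x x' * ⟪φ' x', Γ μ x x' x'' (H x x' x'')⟫| := Finset.abs_sum_le_sum_abs _ _
    _ ≤ ∑ x : Site P j, ∑ x' : Site P j, |∑ x'' : Site P j, η ^ (3 * P.d) *
          ∑ μ : Fin P.d, F μ x x' * ⟪φ' x', Γ μ x x' x'' (H x x' x'')⟫| :=
        Finset.sum_le_sum fun x _ => Finset.abs_sum_le_sum_abs _ _
    _ ≤ ∑ x : Site P j, ∑ x' : Site P j, ∑ x'' : Site P j, |η ^ (3 * P.d) *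
          ∑ μ : Fin P.d, F μ x x' * ⟪φ' x', Γ μ x x' x'' (H x x' x'')⟫| :=
        Finset.sum_le_sum fun x _ => Finset.sum_le_sum fun x' _ => Finset.abs_sum_le_sum_abs _ _
    _ ≤ ∑ x : Site P j, ∑ x' : Site P j, ∑ x'' : Site P j, P.d * c * (η ^ (3 * P.d) * (‖φ' x'‖ * E x x' x'')) :=
        Finset.sum_le_sum fun x _ => Finset.sum_le_sum fun x' _ => Finset.sum_le_sum fun x'' _ => hinner x x' x''
    _ = P.d * c * ∑ x : Site P j, ∑ x' : Site P j, ∑ x'' : Site P j, η ^ (3 * P.d) * (‖φ' x'‖ * E x x' x'') := by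
        rw [Finset.mul_sum]
        refine Finset.sum_congr rfl fun x _ => ?_
        rw [Finset.mul_sum]
        refine Finset.sum_congr rfl fun x' _ => ?_
        rw [Finset.mul_sum]

/-! ## 3. The two transported terms of (3.34) are convergent (degree `+α`) -/

/-- keeping half of an exponential factor costs nothing: `e^{−δu/s} ≤ e^{−½δu/s}` (`u ≥ 0`, `δ, s > 0`). [folklore] -/
private theorem exp_le_exp_half {δ s u : ℝ} (hδ : 0 < δ) (hs : 0 < s) (hu : 0 ≤ u) :
    Real.exp (-(δ * s⁻¹ * u)) ≤ Real.exp (-(δ / 2 * s⁻¹ * u)) := by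
  rw [Real.exp_le_exp]
  have : 0 ≤ δ / 2 * s⁻¹ * u := by positivity
  nlinarith

/-- **First transported term of (3.34) — quantitative bound, PROVED.**  With the tree bound
`‖Γ_μ(x,x′,x″)v‖ ≤ Ke^{−δ|x−x′|/s}e^{−δ|x′−x″|/s}‖v‖`, the Hölder bound `|gA_μ(x) − gA_μ(x′)| ≤ H₁|x−x′|^α` and `‖φ″‖ ≤ B₂`:
`|Σ η^{3d}Σ_μ(gA_μ(x) − gA_μ(x′))φ′(x′)·Γ_μ(x,x′,x″)φ″(x″)| ≤ d·K·H₁·B₂·(1 + 2/δ)·s^α·Σ η^{3d}‖φ′(x′)‖e^{−½δ|x−x′|/s}e^{−½δ|x′−x″|/s}`.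
[cite: Balaban1983Higgs3, (3.34) p.443] -/
theorem abs_tripleSum_first_le (η : ℝ) (hη : 0 < η) {α H₁ B₂ K δ s : ℝ} (hα0 : 0 ≤ α) (hα1 : α ≤ 1) (hH : 0 ≤ H₁)
    (hB : 0 ≤ B₂) (hK : 0 ≤ K) (hδ : 0 < δ) (hs : 0 < s) (Γ : Kernel3 P j W) (g : SiteField P j ℝ) (A : VecField P j ℝ)
    (φ' φ'' : SiteField P j W)
    (hΓ : ∀ (μ : Fin P.d) (x x' x'' : Site P j) (v : W), ‖Γ μ x x' x'' v‖ ≤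
      K * Real.exp (-(δ * s⁻¹ * (η * Site.tdist x x'))) * Real.exp (-(δ * s⁻¹ * (η * Site.tdist x' x''))) * ‖v‖)
    (hgA : ∀ (μ : Fin P.d) (x x' : Site P j), |g x * A ⟨x, μ⟩ - g x' * A ⟨x', μ⟩| ≤ H₁ * (η * Site.tdist x x') ^ α)
    (hφ'' : ∀ x'' : Site P j, ‖φ'' x''‖ ≤ B₂) :
    |tripleSum η Γ (fun μ x x' => g x * A ⟨x, μ⟩ - g x' * A ⟨x', μ⟩) φ' (fun _ _ x'' => φ'' x'')| ≤
      P.d * (K * H₁ * B₂ * (1 + 2 / δ) * s ^ α) *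
        ∑ x : Site P j, ∑ x' : Site P j, ∑ x'' : Site P j, η ^ (3 * P.d) * (‖φ' x'‖ *
          (Real.exp (-(δ / 2 * s⁻¹ * (η * Site.tdist x x'))) * Real.exp (-(δ / 2 * s⁻¹ * (η * Site.tdist x' x''))))) := by
  refine abs_tripleSum_le η hη.le Γ _ φ' _ (K * H₁ * B₂ * (1 + 2 / δ) * s ^ α) _ fun μ x x' x'' => ?_
  set u₁ : ℝ := η * Site.tdist x x' with hu₁
  set u₂ : ℝ := η * Site.tdist x' x'' with hu₂
  have hu₁0 : 0 ≤ u₁ := mul_nonneg hη.le (Nat.cast_nonneg _)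
  have hu₂0 : 0 ≤ u₂ := mul_nonneg hη.le (Nat.cast_nonneg _)
  have hw := exp_mul_rpow_le hδ hs hu₁0 hα0 hα1
  have h2 := exp_le_exp_half hδ hs hu₂0
  have hΓv : ‖Γ μ x x' x'' (φ'' x'')‖ ≤ K * Real.exp (-(δ * s⁻¹ * u₁)) * Real.exp (-(δ * s⁻¹ * u₂)) * B₂ :=
    (hΓ μ x x' x'' _).trans (mul_le_mul_of_nonneg_left (hφ'' x'') (by positivity))
  calc |g x * A ⟨x, μ⟩ - g x' * A ⟨x', μ⟩| * ‖Γ μ x x' x'' (φ'' x'')‖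
      ≤ (H₁ * u₁ ^ α) * (K * Real.exp (-(δ * s⁻¹ * u₁)) * Real.exp (-(δ * s⁻¹ * u₂)) * B₂) :=
        mul_le_mul (hgA μ x x') hΓv (norm_nonneg _) (by positivity)
    _ = K * H₁ * B₂ * ((Real.exp (-(δ * s⁻¹ * u₁)) * u₁ ^ α) * Real.exp (-(δ * s⁻¹ * u₂))) := by ring
    _ ≤ K * H₁ * B₂ * (((1 + 2 / δ) * s ^ α * Real.exp (-(δ / 2 * s⁻¹ * u₁))) * Real.exp (-(δ / 2 * s⁻¹ * u₂))) :=
        mul_le_mul_of_nonneg_left (mul_le_mul hw h2 (Real.exp_pos _).le (by positivity)) (by positivity)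
    _ = K * H₁ * B₂ * (1 + 2 / δ) * s ^ α *
          (Real.exp (-(δ / 2 * s⁻¹ * u₁)) * Real.exp (-(δ / 2 * s⁻¹ * u₂))) := by ring

/-- **Second transported term of (3.34) — quantitative bound, PROVED.**  With the same tree bound on `Γ`, the sup bound
`|gA_μ(x′)| ≤ B₁` and the Hölder bound `‖φ″(x″) − φ″(x′)‖ ≤ H₂|x′−x″|^α`:
`|Σ η^{3d}Σ_μ gA_μ(x′)φ′(x′)·Γ_μ(x,x′,x″)(φ″(x″) − φ″(x′))| ≤ d·K·B₁·H₂·(1 + 2/δ)·s^α·Σ η^{3d}‖φ′(x′)‖e^{−½δ|x−x′|/s}e^{−½δ|x′−x″|/s}`.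
[cite: Balaban1983Higgs3, (3.34) p.443] -/
theorem abs_tripleSum_second_le (η : ℝ) (hη : 0 < η) {α B₁ H₂ K δ s : ℝ} (hα0 : 0 ≤ α) (hα1 : α ≤ 1) (hB : 0 ≤ B₁)
    (hH : 0 ≤ H₂) (hK : 0 ≤ K) (hδ : 0 < δ) (hs : 0 < s) (Γ : Kernel3 P j W) (g : SiteField P j ℝ) (A : VecField P j ℝ)
    (φ' φ'' : SiteField P j W)
    (hΓ : ∀ (μ : Fin P.d) (x x' x'' : Site P j) (v : W), ‖Γ μ x x' x'' v‖ ≤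
      K * Real.exp (-(δ * s⁻¹ * (η * Site.tdist x x'))) * Real.exp (-(δ * s⁻¹ * (η * Site.tdist x' x''))) * ‖v‖)
    (hgA : ∀ (μ : Fin P.d) (x' : Site P j), |g x' * A ⟨x', μ⟩| ≤ B₁)
    (hφ'' : ∀ x' x'' : Site P j, ‖φ'' x'' - φ'' x'‖ ≤ H₂ * (η * Site.tdist x' x'') ^ α) :
    |tripleSum η Γ (fun μ _ x' => g x' * A ⟨x', μ⟩) φ' (fun _ x' x'' => φ'' x'' - φ'' x')| ≤
      P.d * (K * B₁ * H₂ * (1 + 2 / δ) * s ^ α) *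
        ∑ x : Site P j, ∑ x' : Site P j, ∑ x'' : Site P j, η ^ (3 * P.d) * (‖φ' x'‖ *
          (Real.exp (-(δ / 2 * s⁻¹ * (η * Site.tdist x x'))) * Real.exp (-(δ / 2 * s⁻¹ * (η * Site.tdist x' x''))))) := by
  refine abs_tripleSum_le η hη.le Γ _ φ' _ (K * B₁ * H₂ * (1 + 2 / δ) * s ^ α) _ fun μ x x' x'' => ?_
  set u₁ : ℝ := η * Site.tdist x x' with hu₁
  set u₂ : ℝ := η * Site.tdist x' x'' with hu₂
  have hu₁0 : 0 ≤ u₁ := mul_nonneg hη.le (Nat.cast_nonneg _)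
  have hu₂0 : 0 ≤ u₂ := mul_nonneg hη.le (Nat.cast_nonneg _)
  have hw := exp_mul_rpow_le hδ hs hu₂0 hα0 hα1
  have h1 := exp_le_exp_half hδ hs hu₁0
  have hΓv : ‖Γ μ x x' x'' (φ'' x'' - φ'' x')‖ ≤
      K * Real.exp (-(δ * s⁻¹ * u₁)) * Real.exp (-(δ * s⁻¹ * u₂)) * (H₂ * u₂ ^ α) :=
    (hΓ μ x x' x'' _).trans (mul_le_mul_of_nonneg_left (hφ'' x' x'') (by positivity))
  calc |g x' * A ⟨x', μ⟩| * ‖Γ μ x x' x'' (φ'' x'' - φ'' x')‖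
      ≤ B₁ * (K * Real.exp (-(δ * s⁻¹ * u₁)) * Real.exp (-(δ * s⁻¹ * u₂)) * (H₂ * u₂ ^ α)) :=
        mul_le_mul (hgA μ x') hΓv (norm_nonneg _) hB
    _ = K * B₁ * H₂ * (Real.exp (-(δ * s⁻¹ * u₁)) * (Real.exp (-(δ * s⁻¹ * u₂)) * u₂ ^ α)) := by ring
    _ ≤ K * B₁ * H₂ * (Real.exp (-(δ / 2 * s⁻¹ * u₁)) * ((1 + 2 / δ) * s ^ α * Real.exp (-(δ / 2 * s⁻¹ * u₂)))) :=
        mul_le_mul_of_nonneg_left (mul_le_mul h1 hw (by positivity) (Real.exp_pos _).le) (by positivity)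
    _ = K * B₁ * H₂ * (1 + 2 / δ) * s ^ α *
          (Real.exp (-(δ / 2 * s⁻¹ * u₁)) * Real.exp (-(δ / 2 * s⁻¹ * u₂))) := by ring

/-- **p. 444 [PDF 34]: "This gives us a convergent expression plus the expression (3.36)" — quantitative form, PROVED** for the
two transported terms of r15's typed (3.34) (`B3Sect3TriangleGraphs.eq334`, weights `|x−x′|^α = (η·supDist)^α`): under the tree
bound `‖Γ_μ(x,x′,x″)v‖ ≤ Ke^{−δ|x−x′|/s}e^{−δ|x′−x″|/s}‖v‖` (scale `s = L^jη`), Hölder bounds `|gA_μ(x) − gA_μ(x′)| ≤ H₁(η·tdist x x′)^α`,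
`‖φ″(x″) − φ″(x′)‖ ≤ H₂(η·tdist x′ x″)^α` (`0 ≤ α ≤ 1`) and sup bounds `|gA_μ| ≤ B₁`, `‖φ″‖ ≤ B₂`, their sum is at most
`d·K·(H₁B₂ + B₁H₂)·(1 + 2/δ)·s^α·Σ_{x,x′,x″}η^{3d}‖φ′(x′)‖e^{−½δ η·tdist(x,x′)/s}e^{−½δ η·tdist(x′,x″)/s}` — the degree-0 majorant of
(3.33) times the gain `s^α = (L^jη)^α` (degree `+α > 0`: "convergent"). [cite: Balaban1983Higgs3, (3.34) p.444] -/
theorem abs_convergent334_le (η α : ℝ) (hη : 0 < η) {H₁ H₂ B₁ B₂ K δ s : ℝ} (hα0 : 0 ≤ α) (hα1 : α ≤ 1) (hH₁ : 0 ≤ H₁)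
    (hH₂ : 0 ≤ H₂) (hB₁ : 0 ≤ B₁) (hB₂ : 0 ≤ B₂) (hK : 0 ≤ K) (hδ : 0 < δ) (hs : 0 < s) (Γ : Kernel3 P j W)
    (g : SiteField P j ℝ) (A : VecField P j ℝ) (φ' φ'' : SiteField P j W)
    (hΓ : ∀ (μ : Fin P.d) (x x' x'' : Site P j) (v : W), ‖Γ μ x x' x'' v‖ ≤
      K * Real.exp (-(δ * s⁻¹ * (η * Site.tdist x x'))) * Real.exp (-(δ * s⁻¹ * (η * Site.tdist x' x''))) * ‖v‖)
    (hgAH : ∀ (μ : Fin P.d) (x x' : Site P j), |g x * A ⟨x, μ⟩ - g x' * A ⟨x', μ⟩| ≤ H₁ * (η * Site.tdist x x') ^ α)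
    (hgAB : ∀ (μ : Fin P.d) (x' : Site P j), |g x' * A ⟨x', μ⟩| ≤ B₁)
    (hφ''H : ∀ x' x'' : Site P j, ‖φ'' x'' - φ'' x'‖ ≤ H₂ * (η * Site.tdist x' x'') ^ α)
    (hφ''B : ∀ x'' : Site P j, ‖φ'' x''‖ ≤ B₂) :
    |tripleSum η Γ (fun μ x x' => (g x * A ⟨x, μ⟩ - g x' * A ⟨x', μ⟩) / (η * supDist x x') ^ α) φ'
          (fun x x' x'' => (η * supDist x x') ^ α • φ'' x'') +
        tripleSum η Γ (fun μ _ x' => g x' * A ⟨x', μ⟩) φ'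
          (fun _ x' x'' => (η * supDist x'' x') ^ α • (((η * supDist x'' x') ^ α)⁻¹ • (φ'' x'' - φ'' x')))| ≤
      P.d * (K * (H₁ * B₂ + B₁ * H₂) * (1 + 2 / δ) * s ^ α) *
        ∑ x : Site P j, ∑ x' : Site P j, ∑ x'' : Site P j, η ^ (3 * P.d) * (‖φ' x'‖ *
          (Real.exp (-(δ / 2 * s⁻¹ * (η * Site.tdist x x'))) * Real.exp (-(δ / 2 * s⁻¹ * (η * Site.tdist x' x''))))) := by
  have hw : ∀ x x' : Site P j, (η * (supDist x x' : ℝ)) ^ α = 0 → x = x' := fun x x' h => rpow_dist_eq_zero hη α x x' h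
  rw [tripleSum_weight_cancel_first η Γ φ' φ'' (fun x x' => (η * (supDist x x' : ℝ)) ^ α) hw
      (fun μ x x' => g x * A ⟨x, μ⟩ - g x' * A ⟨x', μ⟩) (fun μ x => sub_self _),
    tripleSum_weight_cancel_second η Γ _ φ' φ'' (fun x x' => (η * (supDist x x' : ℝ)) ^ α) hw]
  have h1 := abs_tripleSum_first_le η hη hα0 hα1 hH₁ hB₂ hK hδ hs Γ g A φ' φ'' hΓ hgAH hφ''B
  have h2 := abs_tripleSum_second_le η hη hα0 hα1 hB₁ hH₂ hK hδ hs Γ g A φ' φ'' hΓ hgAB hφ''H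
  set M : ℝ := ∑ x : Site P j, ∑ x' : Site P j, ∑ x'' : Site P j, η ^ (3 * P.d) * (‖φ' x'‖ *
    (Real.exp (-(δ / 2 * s⁻¹ * (η * Site.tdist x x'))) * Real.exp (-(δ / 2 * s⁻¹ * (η * Site.tdist x' x''))))) with hM
  calc _ ≤ P.d * (K * H₁ * B₂ * (1 + 2 / δ) * s ^ α) * M + P.d * (K * B₁ * H₂ * (1 + 2 / δ) * s ^ α) * M :=
        (abs_add_le _ _).trans (add_le_add h1 h2)
    _ = P.d * (K * (H₁ * B₂ + B₁ * H₂) * (1 + 2 / δ) * s ^ α) * M := by ring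

end

end Literature.MathematicalPhysics.QuantumFieldTheory.Balaban1983to89.B3TriangleAlphaGain
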